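import Literature.AlgebraicGeometry.Motives.SegreEmbedding
import Literature.AlgebraicGeometry.Motives.SegreEmbeddingPoints
import Literature.AlgebraicGeometry.Motives.SegrePowers
import Literature.AlgebraicGeometry.Motives.ProjectiveSpaceComplexPointsCohomology
import Literature.AlgebraicGeometry.Motives.ProjectiveSpaceCoordinateEmbedding
import Literature.AlgebraicGeometry.Motives.ProjectiveSpaceLinearMapsPoints
import Literature.AlgebraicGeometry.Motives.AbelianVarietyProduct
import Literature.AlgebraicGeometry.Motives.AbelianVarietyProjectiveChart
import Literature.AlgebraicGeometry.Motives.AbelianVarietyCohomologyExteriorH1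
import Literature.AlgebraicGeometry.HodgeTheory.HolomorphicBundleChernCharacterProjectiveSpace
import Literature.AlgebraicGeometry.HodgeTheory.HolomorphicBundleChernCharacterTopDegree
import Literature.AlgebraicGeometry.HodgeTheory.ComplexBettiKunneth
import Literature.AlgebraicGeometry.HodgeTheory.RationalClassesIndependent
import Literature.AlgebraicGeometry.HodgeTheory.HyperplaneClassRational
import Literature.AlgebraicGeometry.HodgeTheory.AbelianVarietyMultiplicationPullback
import Literature.AlgebraicGeometry.HodgeTheory.AbelianVarietyEndomorphismsHOne
import Literature.Topology.FourManifolds.ComplexProjectiveSpaceHomologyProofs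
import Literature.AlgebraicTopology.SingularHomology.UniversalCoefficientsField
import Literature.AlgebraicTopology.CharacteristicClasses.TautologicalGysin
import HarnessLib

/-!
# The hyperplane class of Segre embeddings on `H²(–(ℂ); ℂ)` and the `K`-symmetric weighted Segre embedding of `A × (E × E)`

Layer `Literature/AlgebraicGeometry/Motives`, companion of `Motives/SegreEmbedding` (the Segre closed
immersion `σ : ℙⁿ ×_k ℙᵐ ↪ ℙⁿᵐ⁺ⁿ⁺ᵐ`), `Motives/SegrePowers` (the Segre–diagonal powers
`s_d : ℙᴺ ⟶ ℙ^{N_d}`, the tree's substitute for Veronese maps) and `Motives/Varieties`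
(`ProjectiveEmbedding`). R. Hartshorne, *Algebraic Geometry* II Ex. 5.11–5.12: `σ^*𝒪(1) ≅ 𝒪(1, 1)`;
E. Markman, arXiv:2509.23403 §11.5 Step 2 (the weights `(m₁, m₂)` on the CM surface `E × E` in the
product trick for abelian varieties of Weil type). This file proves, on the tree's real carriers
`complexBetti X k = Hᵏ(X(ℂ); ℂ)`:

* `SegreHyperplaneClass.eq_zero_of_slices` — the two slices `ℙⁿ × {Q}`, `{P} × ℙᵐ` detect
  `H²((ℙⁿ ×_ℂ ℙᵐ)(ℂ); ℂ)` (the joint restriction is onto `H²(ℙⁿ) ⊕ H²(ℙᵐ)`, and both sides have the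
  same dimension by the Künneth count `finrank_complexBetti_tensor` with `b₀(ℙᴺ(ℂ)) = 1`,
  `b₁(ℙᴺ(ℂ)) = 0`);
* `exists_segreHyperplaneClasses` — **a family of RATIONAL classes `g_N ∈ H²(ℙᴺ_ℂ(ℂ); ℂ)`, non-zero for
  `N ≥ 1`, ADDITIVE under every Segre embedding: `σ(ℂ)^* g = pr₁(ℂ)^* g + pr₂(ℂ)^* g`.** Up to one complex
  scalar `g_N` is the transport along Serre's `projPoint : ℙ(ℂᴺ⁺¹) ≃ₜ ℙᴺ_ℂ(ℂ)` of the Euler class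
  `e(γ¹)` of the tautological line bundle (`CharacteristicClasses.tautEuler`, natural under injective
  linear maps, `tautEuler_map`); along the slices the Segre map IS the projectivisation of the injective
  linear maps `z ↦ z ⊗ w₀`, `w ↦ z₀ ⊗ w` (`ProjectiveSpace.map_segreEmbedding_lift_pointOfVec`); one
  scalar normalises all `N` at once (lines `ℙ¹ ⊂ ℙᴺ`, rational classes on a line differ by a rational
  factor);
* `SegreHyperplaneClass.map_segrePow_of_additive` — `s_d^* g = (d + 1) g`; the Segre–diagonal maps are
  closed immersions;
* `exists_symmetricSegreEmbedding` — **the `K`-symmetric weighted Segre embedding of `A × (E × E)`**: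
  for a complex abelian variety `(A, φ)` with `φ ≫ φ = -(d • 𝟙)`, `d ≥ 1`, an elliptic curve `E` and a
  non-zero rational `η ∈ H²(E(ℂ); ℂ)`, a projective embedding `e_A` of `A` with `K`-SYMMETRIC hyperplane
  class `h_A = e_A^* a_A`, `φ^* h_A = d h_A` (the Segre embedding of `s_{d-1}(e₀) × e₀` precomposed with the
  graph `(𝟙, φ)`; its class is `d h₀ + φ^* h₀` and `φ^*φ^* = (-[d])^* = d²` on `H² = H¹ ⌣ H¹`), and for all
  weights `m₁, m₂ ≥ 1` the Segre embedding `e` of `e_A` with `s_{m₁-1}(e_E) × s_{m₂-1}(e_E)` together with the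
  rational generator `a`, with `e^* a = pr_A^* h_A + s · pr_{E×E}^*(m₁ pr₁^*η + m₂ pr₂^*η)` (`e_E^* g = s η`
  on the line `H²(E(ℂ); ℂ)`).

Provenance: first landed on the summit side for `d = 7` (route `HeckePrymWeil` of the Hodge summit,
files `Theorems/HeckePrymWeilWeilTwelvefoldsSqrtMinus7{SegreSlices,SegreHyperplaneClass,SymmetricSegre}`,
same statements and proofs); re-hosted here for every `d ≥ 1` because its consumers are Literature facts
(the aiming lemma `Motives.exists_cmWeilSurface_aimedSplitProduct_of_ne_one_of_ne_three`,
`HodgeTheory.exists_weilTypeSurface_prod_isHyperbolicWeilType_all`), whose discharges cannot import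
`Summits` (CONVENTIONS §2). Helper lemmas live in the sub-namespace `SegreHyperplaneClass`.
Everything is proved; no definition and no named fact is introduced.

## References

* [Hartshorne1977] R. Hartshorne, Algebraic Geometry (1977), II Cor. 4.2, Ex. 4.8–4.9, Ex. 5.11–5.12.
* [MilnorStasheff1974] J. Milnor, J. Stasheff, Characteristic Classes (1974), §14 Thm. 14.4, p. 158.
* [HatcherAT2002] A. Hatcher, Algebraic Topology (2002), §3.1 Thm. 3.2, p. 199, §3.2 Thm. 3.16, 3.19.
* [VoisinHodgeI2002] C. Voisin, Hodge Theory and Complex Algebraic Geometry I (2002), §7.1.1, §11.3.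
* [Markman2025SurveySecant] E. Markman, arXiv:2509.23403, §11.5 Step 2.
* [MumfordAV1970] D. Mumford, Abelian Varieties (1970), §1 (3), §6 Application 1, §19.
-/

noncomputable section

open CategoryTheory AlgebraicGeometry MonoidalCategory CartesianMonoidalCategory Function
open Literature.AlgebraicGeometry Literature.AlgebraicGeometry.Motives
  Literature.AlgebraicGeometry.HodgeTheory Literature.AlgebraicTopology.SingularHomology
  Literature.AlgebraicTopology.CharacteristicClasses Literature.NumberTheory.Transcendental
open scoped LinearAlgebra.Projectivization

namespace Literature.AlgebraicGeometry.Motives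

namespace SegreHyperplaneClass

/-! ## Betti numbers `b₀ = 1`, `b₁ = 0` of `ℙᴺ_ℂ(ℂ)` -/

/-- `H¹(ℂℙᴺ; ℂ) = 0` (universal coefficients over a field and `H₁(ℂℙᴺ) = 0`).
[cite: HatcherAT2002, §3.1 Thm. 3.2 and §2.2 p. 140] -/
theorem finrank_singularCohomology_one_complexProjectiveSpace (N : ℕ) :
    Module.finrank ℂ (singularCohomology ℂ ℂ (Literature.Topology.FourManifolds.ComplexProjectiveSpace N) 1) = 0 := by
  have hz := ((Literature.Topology.FourManifolds.singularHomology_complexProjectiveSpace_of_module ℂ ℂ N 1).2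
    (fun h ↦ by obtain ⟨⟨r, hr⟩, -⟩ := h; omega))
  haveI : Subsingleton (singularHomology ℂ ℂ (Literature.Topology.FourManifolds.ComplexProjectiveSpace N) 1) :=
    ModuleCat.subsingleton_of_isZero hz
  rw [(LinearEquiv.ofBijective _ (kroneckerPairing_bijective_of_field ℂ
    (Literature.Topology.FourManifolds.ComplexProjectiveSpace N) 1)).finrank_eq]
  exact Module.finrank_zero_of_subsingleton

/-- `b₀(ℙᴺ_ℂ(ℂ)) = 1`. [cite: HatcherAT2002, §3.1 p. 199] -/
theorem finrank_complexBetti_projectiveSpace_zero (N : ℕ) :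
    Module.finrank ℂ (complexBetti (projectiveSpace N ℂ) 0) = 1 := by
  haveI := Literature.Topology.FourManifolds.ComplexProjectiveSpace.pathConnectedSpace N
  rw [← Literature.Topology.FourManifolds.ComplexProjectiveSpace.finrank_singularCohomology_zero (K := ℂ)
    (X := Literature.Topology.FourManifolds.ComplexProjectiveSpace N)]
  exact (singularCohomology.mapIso ℂ ℂ (complexPointsProjectiveSpaceHomeomorph N) 0).toLinearEquiv.finrank_eq.symm

/-- `b₁(ℙᴺ_ℂ(ℂ)) = 0`. [cite: HatcherAT2002, Thm. 3.19] -/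
theorem finrank_complexBetti_projectiveSpace_one (N : ℕ) :
    Module.finrank ℂ (complexBetti (projectiveSpace N ℂ) 1) = 0 := by
  rw [← finrank_singularCohomology_one_complexProjectiveSpace N]
  exact (singularCohomology.mapIso ℂ ℂ (complexPointsProjectiveSpaceHomeomorph N) 1).toLinearEquiv.finrank_eq.symm

/-! ## Maps through a point kill `H²` -/

/-- A map factoring through a point induces `0` on `H²` (`H²(pt) = 0`).
[cite: HatcherAT2002, §3.1 p. 199] -/
theorem map_two_eq_zero_of_factors {X Y : Type} [TopologicalSpace X] [TopologicalSpace Y]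
    (f : C(X, Y)) (y₀ : Y) (hf : ∀ x, f x = y₀) (c : singularCohomology ℂ ℂ Y 2) :
    singularCohomology.map ℂ ℂ f 2 c = 0 := by
  have hfac : f = (ContinuousMap.const PUnit.{1} y₀).comp (ContinuousMap.const X PUnit.unit) := by
    refine ContinuousMap.ext fun x ↦ ?_
    rw [hf x]
    rfl
  have hz : Limits.IsZero (singularCohomology ℂ ℂ PUnit.{1} 2) :=
    singularCochainComplex.isZero_singularCohomology_of_subsingleton' (R := ℂ) (M := ℂ) (by omega)
  haveI := ModuleCat.subsingleton_of_isZero hz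
  rw [hfac, singularCohomology.map_comp, ModuleCat.comp_apply,
    Subsingleton.elim (singularCohomology.map ℂ ℂ (ContinuousMap.const PUnit.{1} y₀) 2 c) 0, map_zero]

/-! ## The two slices of `(ℙⁿ ×_ℂ ℙᵐ)(ℂ)` and the classes they detect -/

section Slices

variable (n m : ℕ)

/-- `fst ∘ (P ↦ (P, Q)) = 𝟙`. [folklore] -/
theorem fst_comp_sliceL (Q : ComplexPoints (projectiveSpace m ℂ)) :
    (AlgPoints.mapContinuous (L := ℂ) (fst (projectiveSpace n ℂ) (projectiveSpace m ℂ))).comp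
      (⟨fun P' ↦ AlgPoints.prodEquiv.symm (P', Q),
          AlgPoints.continuous_prodEquiv_symm.comp (continuous_id.prodMk continuous_const)⟩ :
        C(ComplexPoints (projectiveSpace n ℂ), ComplexPoints (projectiveSpace n ℂ ⊗ projectiveSpace m ℂ))) =
      ContinuousMap.id _ := by
  refine ContinuousMap.ext fun P ↦ ?_
  change AlgPoints.map (fst _ _) (AlgPoints.prodEquiv.symm (P, Q)) = P
  rw [← AlgPoints.prodEquiv_apply_fst, Equiv.apply_symm_apply]

/-- `snd ∘ (P ↦ (P, Q)) = const Q`. [folklore] -/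
theorem snd_comp_sliceL (Q : ComplexPoints (projectiveSpace m ℂ)) (P : ComplexPoints (projectiveSpace n ℂ)) :
    (AlgPoints.mapContinuous (L := ℂ) (snd (projectiveSpace n ℂ) (projectiveSpace m ℂ))).comp
      (⟨fun P' ↦ AlgPoints.prodEquiv.symm (P', Q),
          AlgPoints.continuous_prodEquiv_symm.comp (continuous_id.prodMk continuous_const)⟩ :
        C(ComplexPoints (projectiveSpace n ℂ), ComplexPoints (projectiveSpace n ℂ ⊗ projectiveSpace m ℂ))) P = Q := by
  change AlgPoints.map (snd _ _) (AlgPoints.prodEquiv.symm (P, Q)) = Q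
  rw [← AlgPoints.prodEquiv_apply_snd, Equiv.apply_symm_apply]

/-- `snd ∘ (Q ↦ (P, Q)) = 𝟙`. [folklore] -/
theorem snd_comp_sliceR (P : ComplexPoints (projectiveSpace n ℂ)) :
    (AlgPoints.mapContinuous (L := ℂ) (snd (projectiveSpace n ℂ) (projectiveSpace m ℂ))).comp
      (⟨fun Q' ↦ AlgPoints.prodEquiv.symm (P, Q'),
          AlgPoints.continuous_prodEquiv_symm.comp (continuous_const.prodMk continuous_id)⟩ :
        C(ComplexPoints (projectiveSpace m ℂ), ComplexPoints (projectiveSpace n ℂ ⊗ projectiveSpace m ℂ))) =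
      ContinuousMap.id _ := by
  refine ContinuousMap.ext fun Q ↦ ?_
  change AlgPoints.map (snd _ _) (AlgPoints.prodEquiv.symm (P, Q)) = Q
  rw [← AlgPoints.prodEquiv_apply_snd, Equiv.apply_symm_apply]

/-- `fst ∘ (Q ↦ (P, Q)) = const P`. [folklore] -/
theorem fst_comp_sliceR (P : ComplexPoints (projectiveSpace n ℂ)) (Q : ComplexPoints (projectiveSpace m ℂ)) :
    (AlgPoints.mapContinuous (L := ℂ) (fst (projectiveSpace n ℂ) (projectiveSpace m ℂ))).comp
      (⟨fun Q' ↦ AlgPoints.prodEquiv.symm (P, Q'),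
          AlgPoints.continuous_prodEquiv_symm.comp (continuous_const.prodMk continuous_id)⟩ :
        C(ComplexPoints (projectiveSpace m ℂ), ComplexPoints (projectiveSpace n ℂ ⊗ projectiveSpace m ℂ))) Q = P := by
  change AlgPoints.map (fst _ _) (AlgPoints.prodEquiv.symm (P, Q)) = P
  rw [← AlgPoints.prodEquiv_apply_fst, Equiv.apply_symm_apply]

/-- `dim H²((ℙⁿ × ℙᵐ)(ℂ); ℂ) = b₂(ℙⁿ) + b₂(ℙᵐ)` (Künneth with `b₀ = 1`, `b₁ = 0`).
[cite: HatcherAT2002, §3.2 Thm. 3.16] -/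
theorem finrank_complexBetti_prod_two :
    Module.finrank ℂ (complexBetti (projectiveSpace n ℂ ⊗ projectiveSpace m ℂ) 2) =
      Module.finrank ℂ (complexBetti (projectiveSpace n ℂ) 2) + Module.finrank ℂ (complexBetti (projectiveSpace m ℂ) 2) := by
  rw [finrank_complexBetti_tensor (isSmoothProjective_projectiveSpace' n) (isSmoothProjective_projectiveSpace' m) 2,
    Finset.sum_range_succ, Finset.sum_range_succ, Finset.sum_range_one,
    finrank_complexBetti_projectiveSpace_zero, finrank_complexBetti_projectiveSpace_zero,
    finrank_complexBetti_projectiveSpace_one]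
  simp

/-- **The two slices detect `H²((ℙⁿ × ℙᵐ)(ℂ); ℂ)`**: a degree-two class restricting to zero on
`ℙⁿ × {Q}` and on `{P} × ℙᵐ` is zero (the restriction map to the two slices is onto
`H²(ℙⁿ) ⊕ H²(ℙᵐ)`, and both sides have the same dimension by Künneth). [cite: HatcherAT2002, §3.2 Thm. 3.16] -/
theorem eq_zero_of_slices (P : ComplexPoints (projectiveSpace n ℂ)) (Q : ComplexPoints (projectiveSpace m ℂ))
    (c : complexBetti (projectiveSpace n ℂ ⊗ projectiveSpace m ℂ) 2)
    (hL : singularCohomology.map ℂ ℂ (⟨fun P' ↦ AlgPoints.prodEquiv.symm (P', Q),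
          AlgPoints.continuous_prodEquiv_symm.comp (continuous_id.prodMk continuous_const)⟩ :
        C(ComplexPoints (projectiveSpace n ℂ), ComplexPoints (projectiveSpace n ℂ ⊗ projectiveSpace m ℂ))) 2 c = 0)
    (hR : singularCohomology.map ℂ ℂ (⟨fun Q' ↦ AlgPoints.prodEquiv.symm (P, Q'),
          AlgPoints.continuous_prodEquiv_symm.comp (continuous_const.prodMk continuous_id)⟩ :
        C(ComplexPoints (projectiveSpace m ℂ), ComplexPoints (projectiveSpace n ℂ ⊗ projectiveSpace m ℂ))) 2 c = 0) :
    c = 0 := by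
  set ιL : C(ComplexPoints (projectiveSpace n ℂ), ComplexPoints (projectiveSpace n ℂ ⊗ projectiveSpace m ℂ)) :=
    ⟨fun P' ↦ AlgPoints.prodEquiv.symm (P', Q),
      AlgPoints.continuous_prodEquiv_symm.comp (continuous_id.prodMk continuous_const)⟩ with hιL
  set ιR : C(ComplexPoints (projectiveSpace m ℂ), ComplexPoints (projectiveSpace n ℂ ⊗ projectiveSpace m ℂ)) :=
    ⟨fun Q' ↦ AlgPoints.prodEquiv.symm (P, Q'),
      AlgPoints.continuous_prodEquiv_symm.comp (continuous_const.prodMk continuous_id)⟩ with hιR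
  haveI := finite_complexBetti (isSmoothProjective_projectiveSpace' n) 2
  haveI := finite_complexBetti (isSmoothProjective_projectiveSpace' m) 2
  haveI := finite_complexBetti ((isSmoothProjective_projectiveSpace' n).tensor_holds (isSmoothProjective_projectiveSpace' m)) 2
  let ρ : complexBetti (projectiveSpace n ℂ ⊗ projectiveSpace m ℂ) 2 →ₗ[ℂ]
      complexBetti (projectiveSpace n ℂ) 2 × complexBetti (projectiveSpace m ℂ) 2 :=
    LinearMap.prod (singularCohomology.map ℂ ℂ ιL 2).hom (singularCohomology.map ℂ ℂ ιR 2).hom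
  have hsurj : Function.Surjective ρ := by
    rintro ⟨a, b⟩
    refine ⟨complexBetti.map (fst _ _) 2 a + complexBetti.map (snd _ _) 2 b, ?_⟩
    have h1 : singularCohomology.map ℂ ℂ ιL 2 (complexBetti.map (fst _ _) 2 a) = a := by
      rw [complexBetti.map, ← ModuleCat.comp_apply, ← singularCohomology.map_comp, hιL, fst_comp_sliceL,
        singularCohomology.map_id, ModuleCat.id_apply]
    have h2 : singularCohomology.map ℂ ℂ ιL 2 (complexBetti.map (snd _ _) 2 b) = 0 := by
      rw [complexBetti.map, ← ModuleCat.comp_apply, ← singularCohomology.map_comp]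
      exact map_two_eq_zero_of_factors _ Q (snd_comp_sliceL n m Q) b
    have h3 : singularCohomology.map ℂ ℂ ιR 2 (complexBetti.map (fst _ _) 2 a) = 0 := by
      rw [complexBetti.map, ← ModuleCat.comp_apply, ← singularCohomology.map_comp]
      exact map_two_eq_zero_of_factors _ P (fst_comp_sliceR n m P) a
    have h4 : singularCohomology.map ℂ ℂ ιR 2 (complexBetti.map (snd _ _) 2 b) = b := by
      rw [complexBetti.map, ← ModuleCat.comp_apply, ← singularCohomology.map_comp, hιR, snd_comp_sliceR,
        singularCohomology.map_id, ModuleCat.id_apply]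
    simp only [ρ, LinearMap.prod_apply, map_add]
    change (singularCohomology.map ℂ ℂ ιL 2 _ + singularCohomology.map ℂ ℂ ιL 2 _,
      singularCohomology.map ℂ ℂ ιR 2 _ + singularCohomology.map ℂ ℂ ιR 2 _) = (a, b)
    rw [h1, h2, h3, h4, add_zero, zero_add]
  have hdim : Module.finrank ℂ (complexBetti (projectiveSpace n ℂ ⊗ projectiveSpace m ℂ) 2) =
      Module.finrank ℂ (complexBetti (projectiveSpace n ℂ) 2 × complexBetti (projectiveSpace m ℂ) 2) := by
    rw [Module.finrank_prod, finrank_complexBetti_prod_two]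
  have hinj : Function.Injective ρ := (LinearMap.injective_iff_surjective_of_finrank_eq_finrank hdim).2 hsurj
  refine hinj ?_
  rw [map_zero]
  change (singularCohomology.map ℂ ℂ ιL 2 c, singularCohomology.map ℂ ℂ ιR 2 c) = 0
  rw [hL, hR]
  rfl

end Slices

/-! ## Two rational classes on a line differ by a rational factor -/

/-- **Two rational classes on a line differ by a rational factor**: if `c ≠ 0` and `z • c` are both
rational classes then `z ∈ ℚ` (rational classes satisfying a complex linear relation satisfy a rational
one, `linearIndependent_of_isRationalClass`). [cite: VoisinHodgeI2002, §7.1.1] -/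
theorem exists_ratCast_eq_of_isRationalClass_smul {Y : Type} [TopologicalSpace Y] {k : ℕ}
    {c : singularCohomology ℂ ℂ Y k} (hc : IsRationalClass c) (hc0 : c ≠ 0) {z : ℂ}
    (hz : IsRationalClass (z • c)) : ∃ q : ℚ, (q : ℂ) = z := by
  classical
  by_contra hcon
  push Not at hcon
  have hind : LinearIndependent ℂ ![c, z • c] := by
    refine linearIndependent_of_isRationalClass (fun j ↦ ?_) fun q hq ↦ ?_
    · fin_cases j
      · exact hc
      · exact hz
    · rw [Fin.sum_univ_two] at hq
      simp only [Matrix.cons_val_zero, Matrix.cons_val_one, Matrix.cons_val_fin_one] at hq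
      have h' : ((q 0 : ℂ) + (q 1 : ℂ) * z) • c = 0 := by rw [add_smul, mul_smul, hq]
      have hcoef : (q 0 : ℂ) + (q 1 : ℂ) * z = 0 := (smul_eq_zero.1 h').resolve_right hc0
      by_cases hq1 : q 1 = 0
      · have hq0 : (q 0 : ℂ) = 0 := by rw [hq1, Rat.cast_zero, zero_mul, add_zero] at hcoef; exact hcoef
        funext j
        fin_cases j
        · exact_mod_cast hq0
        · exact hq1
      · exfalso
        refine hcon (-q 0 / q 1) ?_
        have hq1' : ((q 1 : ℚ) : ℂ) ≠ 0 := by exact_mod_cast hq1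
        push_cast
        field_simp
        linear_combination -hcoef
  have h := (LinearIndependent.pair_iff.1 hind) z (-1) (by rw [neg_one_smul, add_neg_cancel])
  exact one_ne_zero (neg_eq_zero.1 h.2)

/-! ## Families of classes transporting `e(γ¹)` -/

section Gen

variable (g : (N : ℕ) → complexBetti (projectiveSpace N ℂ) 2)

/-- `g_0 = 0`: `H²(ℙ⁰_ℂ(ℂ); ℂ) = 0`. [folklore] -/
theorem gen_zero : g 0 = 0 :=
  haveI : Subsingleton (complexBetti (projectiveSpace 0 ℂ) 2) :=
    ComplexPoints.subsingleton_singularCohomology_of_lt (isSmoothProjective_projectiveSpace' 0) ℂ (k := 2) (by omega)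
  Subsingleton.elim _ _

/-- `e(γ¹) ≠ 0` in `H²(ℙ(ℂᴺ⁺¹); ℂ)` for `N ≥ 1` (every class of `H²` is `y ⌣ e(γ¹)`, and `H² ≠ 0`).
[cite: MilnorStasheff1974, §14 Thm. 14.4] -/
theorem tautEuler_ne_zero {N : ℕ} (hN : 1 ≤ N) : tautEuler (Fin (N + 1) → ℂ) ℂ 1 ≠ 0 := by
  intro hx
  have hsurj := cup_tautEuler_surjective (Fin (N + 1) → ℂ) ℂ (n := N + 1) (Module.finrank_fin_fun ℂ) (by omega)
    (k := 0) (by omega)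
  have h1 := Literature.Topology.FourManifolds.ComplexProjectiveSpace.finrank_singularCohomology_two_mul_eq_one ℂ N 1 hN
  have hall : ∀ c : singularCohomology ℂ ℂ (ℙ ℂ (Fin (N + 1) → ℂ)) 2, c = 0 := by
    intro c
    obtain ⟨y, rfl⟩ := hsurj c
    change cupProduct _ y (tautEuler (Fin (N + 1) → ℂ) ℂ 1) = 0
    rw [hx, map_zero]
  haveI : Subsingleton (singularCohomology ℂ ℂ (ℙ ℂ (Fin (N + 1) → ℂ)) 2) :=
    subsingleton_of_forall_eq 0 hall
  have h0 : Module.finrank ℂ (singularCohomology ℂ ℂ (ℙ ℂ (Fin (N + 1) → ℂ)) 2) = 0 :=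
    Module.finrank_zero_of_subsingleton
  exact one_ne_zero (h1.symm.trans h0)

/-- **There is a family `g` transporting `e(γ¹)`**: `g_N :=` the pull-back of `e(γ¹)_N` along
`projPoint⁻¹ : ℙᴺ_ℂ(ℂ) → ℙ(ℂᴺ⁺¹)`. [folklore] -/
theorem exists_gen : ∃ g : (N : ℕ) → complexBetti (projectiveSpace N ℂ) 2, ∀ N : ℕ,
    singularCohomology.map ℂ ℂ (⟨projPoint N, (isHomeomorph_projPoint N).continuous⟩ :
      C(ℙ ℂ (Fin (N + 1) → ℂ), ComplexPoints (projectiveSpace N ℂ))) 2 (g N) = tautEuler (Fin (N + 1) → ℂ) ℂ 1 := by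
  refine ⟨fun N ↦ singularCohomology.map ℂ ℂ ((isHomeomorph_projPoint N).homeomorph.symm :
      C(ComplexPoints (projectiveSpace N ℂ), ℙ ℂ (Fin (N + 1) → ℂ))) 2 (tautEuler (Fin (N + 1) → ℂ) ℂ 1), fun N ↦ ?_⟩
  have hc : ((isHomeomorph_projPoint N).homeomorph.symm :
      C(ComplexPoints (projectiveSpace N ℂ), ℙ ℂ (Fin (N + 1) → ℂ))).comp
      (⟨projPoint N, (isHomeomorph_projPoint N).continuous⟩ :
        C(ℙ ℂ (Fin (N + 1) → ℂ), ComplexPoints (projectiveSpace N ℂ))) = ContinuousMap.id _ :=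
    ContinuousMap.ext fun p ↦ (isHomeomorph_projPoint N).homeomorph.symm_apply_apply p
  rw [← ModuleCat.comp_apply, ← singularCohomology.map_comp, hc, singularCohomology.map_id]
  rfl

variable (hg : ∀ N : ℕ, singularCohomology.map ℂ ℂ (⟨projPoint N, (isHomeomorph_projPoint N).continuous⟩ :
      C(ℙ ℂ (Fin (N + 1) → ℂ), ComplexPoints (projectiveSpace N ℂ))) 2 (g N) = tautEuler (Fin (N + 1) → ℂ) ℂ 1)
include hg

/-- `g_N` is the pull-back of `e(γ¹)_N` along `projPoint⁻¹`. [folklore] -/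
theorem gen_eq (N : ℕ) : g N = singularCohomology.map ℂ ℂ ((isHomeomorph_projPoint N).homeomorph.symm :
      C(ComplexPoints (projectiveSpace N ℂ), ℙ ℂ (Fin (N + 1) → ℂ))) 2 (tautEuler (Fin (N + 1) → ℂ) ℂ 1) := by
  have hc : (⟨projPoint N, (isHomeomorph_projPoint N).continuous⟩ :
        C(ℙ ℂ (Fin (N + 1) → ℂ), ComplexPoints (projectiveSpace N ℂ))).comp
      ((isHomeomorph_projPoint N).homeomorph.symm :
        C(ComplexPoints (projectiveSpace N ℂ), ℙ ℂ (Fin (N + 1) → ℂ))) = ContinuousMap.id _ := by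
    refine ContinuousMap.ext fun p ↦ ?_
    have h := (isHomeomorph_projPoint N).homeomorph.apply_symm_apply p
    rwa [IsHomeomorph.homeomorph_apply] at h
  rw [← hg N, ← ModuleCat.comp_apply, ← singularCohomology.map_comp, hc, singularCohomology.map_id]
  rfl

/-- `g_N ≠ 0` for `N ≥ 1`. [folklore] -/
theorem gen_ne_zero {N : ℕ} (hN : 1 ≤ N) : g N ≠ 0 := fun h ↦
  tautEuler_ne_zero hN (by rw [← hg N, h, map_zero])

/-! ## The Segre embedding on `H²`: `σ^* g = pr₁^* g + pr₂^* g` -/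

/-- **The hyperplane class of the Segre embedding** on the complex points: for the Segre map
`σ : ℙⁿ ×_ℂ ℙᵐ → ℙⁿᵐ⁺ⁿ⁺ᵐ` of `Motives/SegreEmbedding` and a family `g` transporting the Euler classes of
the tautological line bundles, `σ(ℂ)^* g = pr₁(ℂ)^* g + pr₂(ℂ)^* g` in `H²((ℙⁿ × ℙᵐ)(ℂ); ℂ)`
(`σ^*𝒪(1) = 𝒪(1, 1)`). Proof: both sides agree on the two slices `ℙⁿ × {[w₀]}`, `{[z₀]} × ℙᵐ`, along
which `σ` is the projectivisation of the injective linear maps `z ↦ z ⊗ w₀`, `w ↦ z₀ ⊗ w`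
(`map_segreEmbedding_lift_pointOfVec`) so that naturality of `e(γ¹)` applies (`tautEuler_map`), and the
two slices detect `H²` (`eq_zero_of_slices`). [cite: Hartshorne1977, II Ex. 5.11 and Ex. 5.12] -/
theorem map_segreEmbedding_gen (n m : ℕ) :
    complexBetti.map (segreEmbedding n m ℂ) 2 (g (n * m + n + m)) =
      complexBetti.map (fst (projectiveSpace n ℂ) (projectiveSpace m ℂ)) 2 (g n) +
        complexBetti.map (snd (projectiveSpace n ℂ) (projectiveSpace m ℂ)) 2 (g m) := by
  -- two base points
  have hz₀ : (fun _ ↦ (1 : ℂ) : Fin (n + 1) → ℂ) ≠ 0 := Function.ne_iff.2 ⟨0, one_ne_zero⟩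
  have hw₀ : (fun _ ↦ (1 : ℂ) : Fin (m + 1) → ℂ) ≠ 0 := Function.ne_iff.2 ⟨0, one_ne_zero⟩
  set z₀ : Fin (n + 1) → ℂ := fun _ ↦ 1 with hz₀def
  set w₀ : Fin (m + 1) → ℂ := fun _ ↦ 1 with hw₀def
  set P₀ : ComplexPoints (projectiveSpace n ℂ) := projPoint n (Projectivization.mk ℂ z₀ hz₀) with hP₀
  set Q₀ : ComplexPoints (projectiveSpace m ℂ) := projPoint m (Projectivization.mk ℂ w₀ hw₀) with hQ₀
  set e := segreIndexEquiv n m with he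
  -- the two slices
  set ιL : C(ComplexPoints (projectiveSpace n ℂ), ComplexPoints (projectiveSpace n ℂ ⊗ projectiveSpace m ℂ)) :=
    ⟨fun P' ↦ AlgPoints.prodEquiv.symm (P', Q₀),
      AlgPoints.continuous_prodEquiv_symm.comp (continuous_id.prodMk continuous_const)⟩ with hιL
  set ιR : C(ComplexPoints (projectiveSpace m ℂ), ComplexPoints (projectiveSpace n ℂ ⊗ projectiveSpace m ℂ)) :=
    ⟨fun Q' ↦ AlgPoints.prodEquiv.symm (P₀, Q'),
      AlgPoints.continuous_prodEquiv_symm.comp (continuous_const.prodMk continuous_id)⟩ with hιR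
  -- the two linear slices of the Segre map
  let Aw : (Fin (n + 1) → ℂ) →ₗ[ℂ] (Fin (n * m + n + m + 1) → ℂ) :=
    { toFun := fun z t ↦ z (e.symm t).1 * w₀ (e.symm t).2
      map_add' := fun a b ↦ funext fun t ↦ by simp only [Pi.add_apply]; ring
      map_smul' := fun c a ↦ funext fun t ↦ by
        simp only [Pi.smul_apply, smul_eq_mul, RingHom.id_apply]; ring }
  have hAw : Injective Aw := by
    intro a b hab
    funext i
    have h := congrFun hab (e (i, 0))
    simp only [Aw, LinearMap.coe_mk, AddHom.coe_mk, Equiv.symm_apply_apply, hw₀def, mul_one] at h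
    exact h
  let Bz : (Fin (m + 1) → ℂ) →ₗ[ℂ] (Fin (n * m + n + m + 1) → ℂ) :=
    { toFun := fun w t ↦ z₀ (e.symm t).1 * w (e.symm t).2
      map_add' := fun a b ↦ funext fun t ↦ by simp only [Pi.add_apply]; ring
      map_smul' := fun c a ↦ funext fun t ↦ by
        simp only [Pi.smul_apply, smul_eq_mul, RingHom.id_apply]; ring }
  have hBz : Injective Bz := by
    intro a b hab
    funext j
    have h := congrFun hab (e (0, j))
    simp only [Bz, LinearMap.coe_mk, AddHom.coe_mk, Equiv.symm_apply_apply, hz₀def, one_mul] at h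
    exact h
  -- along the slices the Segre map is a projectivised linear map
  have hcompL : (AlgPoints.mapContinuous (L := ℂ) (segreEmbedding n m ℂ)).comp ιL =
      (⟨projPoint (n * m + n + m), (isHomeomorph_projPoint (n * m + n + m)).continuous⟩ :
      C(ℙ ℂ (Fin (n * m + n + m + 1) → ℂ), ComplexPoints (projectiveSpace (n * m + n + m) ℂ))).comp
        ((projMapC Aw hAw).comp ((isHomeomorph_projPoint n).homeomorph.symm :
      C(ComplexPoints (projectiveSpace n ℂ), ℙ ℂ (Fin (n + 1) → ℂ)))) := by
    refine ContinuousMap.ext fun P ↦ ?_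
    obtain ⟨p, rfl⟩ := projPoint_surjective n P
    induction p using Projectivization.ind with
    | h z hz =>
      have hs : (isHomeomorph_projPoint n).homeomorph.symm (projPoint n (Projectivization.mk ℂ z hz)) =
          Projectivization.mk ℂ z hz := by
        have h := (isHomeomorph_projPoint n).homeomorph.symm_apply_apply (Projectivization.mk ℂ z hz)
        rwa [IsHomeomorph.homeomorph_apply] at h
      change AlgPoints.map (segreEmbedding n m ℂ) (AlgPoints.prodEquiv.symm (projPoint n (Projectivization.mk ℂ z hz), Q₀)) =
        projPoint (n * m + n + m) (Projectivization.map Aw hAw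
          ((isHomeomorph_projPoint n).homeomorph.symm (projPoint n (Projectivization.mk ℂ z hz))))
      rw [hs, Projectivization.map_mk, projPoint_mk_eq_pointOfVec, hQ₀,
        projPoint_mk_eq_pointOfVec, projPoint_mk_eq_pointOfVec, AlgPoints.prodEquiv_symm_apply,
        ProjectiveSpace.map_segreEmbedding_lift_pointOfVec]
      rfl
  have hcompR : (AlgPoints.mapContinuous (L := ℂ) (segreEmbedding n m ℂ)).comp ιR =
      (⟨projPoint (n * m + n + m), (isHomeomorph_projPoint (n * m + n + m)).continuous⟩ :
      C(ℙ ℂ (Fin (n * m + n + m + 1) → ℂ), ComplexPoints (projectiveSpace (n * m + n + m) ℂ))).comp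
        ((projMapC Bz hBz).comp ((isHomeomorph_projPoint m).homeomorph.symm :
      C(ComplexPoints (projectiveSpace m ℂ), ℙ ℂ (Fin (m + 1) → ℂ)))) := by
    refine ContinuousMap.ext fun Q ↦ ?_
    obtain ⟨q, rfl⟩ := projPoint_surjective m Q
    induction q using Projectivization.ind with
    | h w hw =>
      have hs : (isHomeomorph_projPoint m).homeomorph.symm (projPoint m (Projectivization.mk ℂ w hw)) =
          Projectivization.mk ℂ w hw := by
        have h := (isHomeomorph_projPoint m).homeomorph.symm_apply_apply (Projectivization.mk ℂ w hw)
        rwa [IsHomeomorph.homeomorph_apply] at h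
      change AlgPoints.map (segreEmbedding n m ℂ) (AlgPoints.prodEquiv.symm (P₀, projPoint m (Projectivization.mk ℂ w hw))) =
        projPoint (n * m + n + m) (Projectivization.map Bz hBz
          ((isHomeomorph_projPoint m).homeomorph.symm (projPoint m (Projectivization.mk ℂ w hw))))
      rw [hs, Projectivization.map_mk, projPoint_mk_eq_pointOfVec, hP₀,
        projPoint_mk_eq_pointOfVec, projPoint_mk_eq_pointOfVec, AlgPoints.prodEquiv_symm_apply,
        ProjectiveSpace.map_segreEmbedding_lift_pointOfVec]
      rfl
  -- the values on the slices
  have kL : singularCohomology.map ℂ ℂ ιL 2 (complexBetti.map (segreEmbedding n m ℂ) 2 (g (n * m + n + m))) = g n := by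
    rw [complexBetti.map, ← ModuleCat.comp_apply, ← singularCohomology.map_comp, hcompL,
      singularCohomology.map_comp, singularCohomology.map_comp, ModuleCat.comp_apply, ModuleCat.comp_apply,
      hg, ← tautEuler_map, ← gen_eq g hg n]
  have kR : singularCohomology.map ℂ ℂ ιR 2 (complexBetti.map (segreEmbedding n m ℂ) 2 (g (n * m + n + m))) = g m := by
    rw [complexBetti.map, ← ModuleCat.comp_apply, ← singularCohomology.map_comp, hcompR,
      singularCohomology.map_comp, singularCohomology.map_comp, ModuleCat.comp_apply, ModuleCat.comp_apply,
      hg, ← tautEuler_map, ← gen_eq g hg m]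
  have h1 : singularCohomology.map ℂ ℂ ιL 2 (complexBetti.map (fst _ _) 2 (g n)) = g n := by
    rw [complexBetti.map, ← ModuleCat.comp_apply, ← singularCohomology.map_comp, hιL, fst_comp_sliceL,
      singularCohomology.map_id, ModuleCat.id_apply]
  have h2 : singularCohomology.map ℂ ℂ ιL 2 (complexBetti.map (snd _ _) 2 (g m)) = 0 := by
    rw [complexBetti.map, ← ModuleCat.comp_apply, ← singularCohomology.map_comp]
    exact map_two_eq_zero_of_factors _ Q₀ (snd_comp_sliceL n m Q₀) _
  have h3 : singularCohomology.map ℂ ℂ ιR 2 (complexBetti.map (fst _ _) 2 (g n)) = 0 := by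
    rw [complexBetti.map, ← ModuleCat.comp_apply, ← singularCohomology.map_comp]
    exact map_two_eq_zero_of_factors _ P₀ (fst_comp_sliceR n m P₀) _
  have h4 : singularCohomology.map ℂ ℂ ιR 2 (complexBetti.map (snd _ _) 2 (g m)) = g m := by
    rw [complexBetti.map, ← ModuleCat.comp_apply, ← singularCohomology.map_comp, hιR, snd_comp_sliceR,
      singularCohomology.map_id, ModuleCat.id_apply]
  -- conclude by the detection of `H²` along the slices
  refine sub_eq_zero.1 (eq_zero_of_slices n m P₀ Q₀ _ ?_ ?_)
  · rw [← hιL, map_sub, map_add, kL, h1, h2, add_zero, sub_self]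
  · rw [← hιR, map_sub, map_add, kR, h3, h4, zero_add, sub_self]

/-! ## Normalising `g` to a rational class, uniformly in `N` -/

/-- **A line in `ℙᴺ`** (`N ≥ 1`): a continuous map `ℓ : ℙ¹(ℂ) → ℙᴺ(ℂ)` with `ℓ^* g_N = g_1` — the
projectivisation of a linear injection `ℂ² ↪ ℂᴺ⁺¹`, by naturality of `e(γ¹)`.
[cite: MilnorStasheff1974, §14 p. 158] -/
theorem exists_line_map_gen {N : ℕ} (hN : 1 ≤ N) :
    ∃ ℓ : C(ComplexPoints (projectiveSpace 1 ℂ), ComplexPoints (projectiveSpace N ℂ)),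
      singularCohomology.map ℂ ℂ ℓ 2 (g N) = g 1 := by
  have h2 : 1 + 1 ≤ N + 1 := by omega
  let Lℓ : (Fin (1 + 1) → ℂ) →ₗ[ℂ] (Fin (N + 1) → ℂ) := ExtendByZero.linearMap ℂ (Fin.castLE h2)
  have hLℓ : Injective Lℓ := by
    intro a b hab
    funext i
    have h := congrFun hab (Fin.castLE h2 i)
    simp only [Lℓ, ExtendByZero.linearMap_apply, (Fin.castLE_injective h2).extend_apply] at h
    exact h
  refine ⟨(⟨projPoint N, (isHomeomorph_projPoint N).continuous⟩ :
      C(ℙ ℂ (Fin (N + 1) → ℂ), ComplexPoints (projectiveSpace N ℂ))).comp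
    ((projMapC Lℓ hLℓ).comp ((isHomeomorph_projPoint 1).homeomorph.symm :
      C(ComplexPoints (projectiveSpace 1 ℂ), ℙ ℂ (Fin (1 + 1) → ℂ)))), ?_⟩
  rw [singularCohomology.map_comp, singularCohomology.map_comp, ModuleCat.comp_apply, ModuleCat.comp_apply,
    hg, ← tautEuler_map, ← gen_eq g hg 1]

/-- **Uniform rational normalisation**: there is `u ∈ ℂ`, `u ≠ 0`, such that `u • g_N` is a rational
class for every `N` (`H²(ℙᴺ(ℂ); ℂ)` is a line spanned by a rational class, all `g_N` restrict to `g_1`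
along lines, and rational classes on a line differ by rational factors). [cite: VoisinHodgeI2002, §7.1.1 and §11.3] -/
theorem exists_smul_gen_isRationalClass : ∃ u : ℂ, u ≠ 0 ∧ ∀ N : ℕ, IsRationalClass (u • g N) := by
  obtain ⟨r₁, hr₁, hgen₁⟩ := exists_isRationalClass_forall_eq_smul_projectiveSpace 1
  obtain ⟨z₁, hz₁⟩ := hgen₁ (g 1)
  have hg₁ : g 1 ≠ 0 := gen_ne_zero g hg le_rfl
  have hz₁0 : z₁ ≠ 0 := fun h ↦ hg₁ (by rw [hz₁, h, zero_smul])
  have hr₁0 : r₁ ≠ 0 := fun h ↦ hg₁ (by rw [hz₁, h, smul_zero])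
  refine ⟨z₁⁻¹, inv_ne_zero hz₁0, fun N ↦ ?_⟩
  rcases Nat.eq_zero_or_pos N with rfl | hN
  · rw [gen_zero g, smul_zero]
    exact IsRationalClass.zero
  obtain ⟨r, hr, hgen⟩ := exists_isRationalClass_forall_eq_smul_projectiveSpace N
  obtain ⟨zN, hzN⟩ := hgen (g N)
  have hgN : g N ≠ 0 := gen_ne_zero g hg hN
  have hzN0 : zN ≠ 0 := fun h ↦ hgN (by rw [hzN, h, zero_smul])
  obtain ⟨ℓ, hℓ⟩ := exists_line_map_gen g hg hN
  -- `ℓ^* r = (z₁ / zN) • r₁` is rational, so `z₁ / zN ∈ ℚ`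
  have hℓr : singularCohomology.map ℂ ℂ ℓ 2 r = (z₁ / zN) • r₁ := by
    have h : zN • singularCohomology.map ℂ ℂ ℓ 2 r = z₁ • r₁ := by
      rw [← map_smul, ← hzN, hℓ, hz₁]
    rw [div_eq_mul_inv, mul_comm, mul_smul, ← h, smul_smul, inv_mul_cancel₀ hzN0, one_smul]
  obtain ⟨q, hq⟩ := exists_ratCast_eq_of_isRationalClass_smul hr₁ hr₁0 (z := z₁ / zN)
    (by rw [← hℓr]; exact hr.pullback ℓ)
  have hq0 : q ≠ 0 := by
    rintro rfl
    rw [Rat.cast_zero] at hq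
    exact div_ne_zero hz₁0 hzN0 hq.symm
  have hkey : z₁⁻¹ • g N = ((q⁻¹ : ℚ) : ℂ) • r := by
    rw [hzN, smul_smul, Rat.cast_inv, hq, inv_div, div_eq_mul_inv, mul_comm]
  rw [hkey]
  exact hr.smul q⁻¹

end Gen

/-! ## Segre–diagonal powers: closed immersions of class `(d + 1) • g` -/

section SegrePow

/-- `ℙᴺ_ℂ → Spec ℂ` is separated (it is proper). [cite: Hartshorne1977, II.4.9] -/
theorem isSeparated_projectiveSpace_hom (N : ℕ) : IsSeparated (projectiveSpace N ℂ).hom := by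
  haveI : IsProper (projectiveSpace N ℂ).hom :=
    Motives.IsSmoothProjective.isProper_holds (isSmoothProjective_projectiveSpace' N)
  infer_instance

/-- The graph `(f, 𝟙) : X ⟶ Y ⊗ X` is a closed immersion for `Y` separated over `ℂ` (a section of the
separated projection `Y ⊗ X → X`). [cite: Hartshorne1977, II Cor. 4.2 and Ex. 4.8] -/
theorem isClosedImmersion_lift_id_right {X Y : SchemeOver ℂ} (f : X ⟶ Y) [IsSeparated Y.hom] :
    IsClosedImmersion (CartesianMonoidalCategory.lift f (𝟙 X)).left := by
  have h : (CartesianMonoidalCategory.lift f (𝟙 X)).left ≫ (snd Y X).left = 𝟙 _ := by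
    rw [← Over.comp_left, CartesianMonoidalCategory.lift_snd]
    rfl
  haveI : IsSeparated (snd Y X).left := inferInstanceAs (IsSeparated (Limits.pullback.snd Y.hom X.hom))
  haveI : IsClosedImmersion ((CartesianMonoidalCategory.lift f (𝟙 X)).left ≫ (snd Y X).left) := by
    rw [h]; infer_instance
  exact IsClosedImmersion.of_comp _ (snd Y X).left

/-- The graph `(𝟙, f) : X ⟶ X ⊗ Y` is a closed immersion for `Y` separated over `ℂ` (a section of the
separated projection `X ⊗ Y → X`). [cite: Hartshorne1977, II Cor. 4.2 and Ex. 4.8] -/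
theorem isClosedImmersion_lift_id_left {X Y : SchemeOver ℂ} (f : X ⟶ Y) [IsSeparated Y.hom] :
    IsClosedImmersion (CartesianMonoidalCategory.lift (𝟙 X) f).left := by
  have h : (CartesianMonoidalCategory.lift (𝟙 X) f).left ≫ (fst X Y).left = 𝟙 _ := by
    rw [← Over.comp_left, CartesianMonoidalCategory.lift_fst]
    rfl
  haveI : IsSeparated (fst X Y).left := inferInstanceAs (IsSeparated (Limits.pullback.fst X.hom Y.hom))
  haveI : IsClosedImmersion ((CartesianMonoidalCategory.lift (𝟙 X) f).left ≫ (fst X Y).left) := by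
    rw [h]; infer_instance
  exact IsClosedImmersion.of_comp _ (fst X Y).left

/-- **The Segre–diagonal maps `s_d : ℙᴺ ⟶ ℙ^{N_d}` are closed immersions** (graph of `s_{d-1}`, then
Segre). [cite: Hartshorne1977, II Ex. 4.9 and Ex. 5.11] -/
theorem isClosedImmersion_segrePow_left (N : ℕ) : ∀ d : ℕ, IsClosedImmersion (ProjectiveSpace.segrePow N ℂ d).left
  | 0 => by
    change IsClosedImmersion (𝟙 (projectiveSpace N ℂ) : projectiveSpace N ℂ ⟶ projectiveSpace N ℂ).left
    exact inferInstanceAs (IsClosedImmersion (𝟙 (projectiveSpace N ℂ).left))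
  | d + 1 => by
    haveI := isClosedImmersion_segrePow_left N d
    haveI := isSeparated_projectiveSpace_hom (ProjectiveSpace.segrePowDim N d)
    haveI := isClosedImmersion_lift_id_right (ProjectiveSpace.segrePow N ℂ d)
    change IsClosedImmersion ((CartesianMonoidalCategory.lift (ProjectiveSpace.segrePow N ℂ d) (𝟙 _)).left ≫
      (segreEmbedding (ProjectiveSpace.segrePowDim N d) N ℂ).left)
    infer_instance

/-- **`s_d^* g = (d + 1) • g` on `H²`** for any Segre-additive family of classes `g` (induction along
`s_{d+1} = (s_d, 𝟙) ≫ σ`). [cite: Hartshorne1977, I Ex. 2.12 and II Ex. 5.11] -/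
theorem map_segrePow_of_additive (g : (N : ℕ) → complexBetti (projectiveSpace N ℂ) 2)
    (hg : ∀ n m : ℕ, complexBetti.map (segreEmbedding n m ℂ) 2 (g (n * m + n + m)) =
      complexBetti.map (fst (projectiveSpace n ℂ) (projectiveSpace m ℂ)) 2 (g n) +
        complexBetti.map (snd (projectiveSpace n ℂ) (projectiveSpace m ℂ)) 2 (g m))
    (N : ℕ) : ∀ d : ℕ, complexBetti.map (ProjectiveSpace.segrePow N ℂ d) 2 (g (ProjectiveSpace.segrePowDim N d)) =
      ((d + 1 : ℕ) : ℂ) • g N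
  | 0 => by
    change complexBetti.map (𝟙 (projectiveSpace N ℂ)) 2 (g N) = _
    rw [complexBetti.map_id, Nat.zero_add, Nat.cast_one, one_smul]
    rfl
  | d + 1 => by
    change complexBetti.map (CartesianMonoidalCategory.lift (ProjectiveSpace.segrePow N ℂ d) (𝟙 _) ≫
      segreEmbedding (ProjectiveSpace.segrePowDim N d) N ℂ) 2 (g (ProjectiveSpace.segrePowDim N d * N +
        ProjectiveSpace.segrePowDim N d + N)) = _
    rw [complexBetti.map_comp, ModuleCat.comp_apply, hg, map_add, ← ModuleCat.comp_apply, ← complexBetti.map_comp,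
      CartesianMonoidalCategory.lift_fst, ← ModuleCat.comp_apply, ← complexBetti.map_comp,
      CartesianMonoidalCategory.lift_snd, complexBetti.map_id, ModuleCat.id_apply, map_segrePow_of_additive g hg N d]
    simp only [Nat.cast_add, Nat.cast_one, add_smul, one_smul]

end SegrePow

/-! ## `(-[d])^* = d²` on `H²` of an abelian variety -/

/-- **`(-(d • 𝟙))^* = d²` on `H²(A(ℂ); ℂ)`**: on `H¹` the homomorphism `-(d • 𝟙)` acts by `-d`
(additivity of `f ↦ f^*|_{H¹}`), and `H²` is spanned by cup products of degree-one classes.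
[cite: MumfordAV1970, §1 (3) and §19] -/
theorem complexBetti_map_neg_nsmul_id_two (A : AbelianVariety ℂ) (d : ℕ) (y : complexBetti A.X 2) :
    complexBetti.map (-(d • 𝟙 A)).hom.hom.hom 2 y = ((d : ℂ) ^ 2) • y := by
  have hφ : (-(d • 𝟙 A) : A ⟶ A) = (-(d : ℤ)) • 𝟙 A + (0 : ℤ) • 𝟙 A := by
    rw [zero_smul, add_zero, neg_smul, natCast_zsmul]
  have hone : ∀ c : complexBetti A.X 1, complexBetti.map (-(d • 𝟙 A)).hom.hom.hom 1 c = (-(d : ℂ)) • c := by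
    intro c
    rw [hφ, complexBetti_map_zsmul_id_add_zsmul_one]
    simp
  have key : ∀ v : Fin 2 → complexBetti A.X 1,
      complexBetti.map (-(d • 𝟙 A)).hom.hom.hom 2 (cupPowOne ℂ (ComplexPoints A.X) 2 v) =
        ((d : ℂ) ^ 2) • cupPowOne ℂ (ComplexPoints A.X) 2 v := by
    intro v
    rw [complexBetti_map_cupPowOne]
    have hv : (fun i ↦ complexBetti.map (-(d • 𝟙 A)).hom.hom.hom 1 (v i)) = fun i ↦ (-(d : ℂ)) • v i :=
      funext fun i ↦ hone (v i)
    rw [hv, MultilinearMap.map_smul_univ, Finset.prod_const, Finset.card_univ, Fintype.card_fin, neg_sq]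
  have hspan := (abelianVarietyCohomologyExteriorH1_holds.hasExteriorCohomologyH1 A).span_range_cupPowOne 2
  have hy : y ∈ Submodule.span ℂ (Set.range (cupPowOne ℂ (ComplexPoints A.X) 2)) := by
    rw [hspan]; exact Submodule.mem_top
  induction hy using Submodule.span_induction with
  | mem x hx =>
    obtain ⟨v, rfl⟩ := hx
    exact key v
  | zero => rw [map_zero, smul_zero]
  | add a b _ _ ha hb => rw [map_add, smul_add, ha, hb]
  | smul r a _ ha => rw [map_smul, ha, smul_comm]

/-! ## Projective embeddings of abelian varieties into `ℙᴺ`, `N ≥ 1` -/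

/-- Every complex abelian variety admits a closed immersion into some `ℙᴺ_ℂ` with `N ≥ 1` (abelian
varieties are projective; bump the dimension by a coordinate hyperplane embedding).
[cite: MumfordAV1970, §6 Application 1 (p. 62)] -/
theorem exists_closedImmersion_projectiveSpace_pos (A : AbelianVariety ℂ) :
    ∃ (N : ℕ) (ι : A.X ⟶ projectiveSpace N ℂ), 1 ≤ N ∧ IsClosedImmersion ι.left := by
  obtain ⟨n, ι, hι⟩ := (Motives.AbelianVariety.isSmoothProjective_holds (A := A)).isProjectiveOver
  refine ⟨n + 1, ι ≫ ProjectiveSpace.skipMap (k := ℂ) (0 : Fin (n + 2)), by omega, ?_⟩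
  change IsClosedImmersion (ι.left ≫ (ProjectiveSpace.skipMap (k := ℂ) (0 : Fin (n + 2))).left)
  infer_instance

/-- On a curve, a rational class of `H²` is a rational multiple of any non-zero rational class
(`dim H²(E(ℂ); ℂ) = 1`). [cite: VoisinHodgeI2002, §7.1.1] -/
theorem exists_eq_ratCast_smul_of_curve (E : AbelianVariety ℂ) (hE : E.dim = 1) {η : complexBetti E.X 2}
    (hη : IsRationalClass η) (hη0 : η ≠ 0) {c : complexBetti E.X 2} (hc : IsRationalClass c) :
    ∃ s : ℚ, c = ((s : ℚ) : ℂ) • η := by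
  have hE1 : Motives.IsSmoothProjective 1 E.X := hE ▸ Motives.AbelianVariety.isSmoothProjective_holds
  have h1 : Module.finrank ℂ (complexBetti E.X 2) = 1 := finrank_complexBetti_two_mul_eq_one hE1
  obtain ⟨t, ht⟩ := (finrank_eq_one_iff_of_nonzero' η hη0).1 h1 c
  obtain ⟨q, hq⟩ := SegreHyperplaneClass.exists_ratCast_eq_of_isRationalClass_smul hη hη0
    (z := t) (by rw [ht]; exact hc)
  exact ⟨q, by rw [hq, ht]⟩

/-! ## Functoriality bookkeeping on `H•(–(ℂ); ℂ)` -/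

section Bookkeeping

variable {T X Y X' Y' Z : SchemeOver ℂ}

/-- `(f ≫ g)^* x = f^* (g^* x)`. [folklore] -/
theorem map_comp_apply' (f : X ⟶ Y) (g : Y ⟶ Z) (i : ℕ) (x : complexBetti Z i) :
    complexBetti.map (f ≫ g) i x = complexBetti.map f i (complexBetti.map g i x) := by
  rw [complexBetti.map_comp, ModuleCat.comp_apply]

/-- `(f ⊗ g)^* pr₁^* x = pr₁^* f^* x`. [folklore] -/
theorem map_tensorHom_map_fst (f : X ⟶ X') (g : Y ⟶ Y') (i : ℕ) (x : complexBetti X' i) :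
    complexBetti.map (f ⊗ₘ g) i (complexBetti.map (fst X' Y') i x) = complexBetti.map (fst X Y) i (complexBetti.map f i x) := by
  rw [← map_comp_apply', CartesianMonoidalCategory.tensorHom_fst, map_comp_apply']

/-- `(f ⊗ g)^* pr₂^* y = pr₂^* g^* y`. [folklore] -/
theorem map_tensorHom_map_snd (f : X ⟶ X') (g : Y ⟶ Y') (i : ℕ) (y : complexBetti Y' i) :
    complexBetti.map (f ⊗ₘ g) i (complexBetti.map (snd X' Y') i y) = complexBetti.map (snd X Y) i (complexBetti.map g i y) := by
  rw [← map_comp_apply', CartesianMonoidalCategory.tensorHom_snd, map_comp_apply']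

/-- `(f, g)^* pr₁^* x = f^* x`. [folklore] -/
theorem map_lift_map_fst (f : T ⟶ X) (g : T ⟶ Y) (i : ℕ) (x : complexBetti X i) :
    complexBetti.map (CartesianMonoidalCategory.lift f g) i (complexBetti.map (fst X Y) i x) = complexBetti.map f i x := by
  rw [← map_comp_apply', CartesianMonoidalCategory.lift_fst]

/-- `(f, g)^* pr₂^* y = g^* y`. [folklore] -/
theorem map_lift_map_snd (f : T ⟶ X) (g : T ⟶ Y) (i : ℕ) (y : complexBetti Y i) :
    complexBetti.map (CartesianMonoidalCategory.lift f g) i (complexBetti.map (snd X Y) i y) = complexBetti.map g i y := by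
  rw [← map_comp_apply', CartesianMonoidalCategory.lift_snd]

end Bookkeeping

end SegreHyperplaneClass

open SegreHyperplaneClass

/-! ## The packaged statements -/

/-- **Hyperplane classes of Segre embeddings on `H²(–(ℂ); ℂ)`.** There is a family of RATIONAL classes
`g_N ∈ H²(ℙᴺ_ℂ(ℂ); ℂ)`, non-zero for `N ≥ 1` (hence generators of the line `H²(ℙᴺ(ℂ); ℂ)`), which is
ADDITIVE under every Segre embedding `σ : ℙⁿ ×_ℂ ℙᵐ ↪ ℙⁿᵐ⁺ⁿ⁺ᵐ` of `Motives/SegreEmbedding`: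
`σ(ℂ)^* g = pr₁(ℂ)^* g + pr₂(ℂ)^* g` — the Betti shadow of `σ^*𝒪(1) ≅ pr₁^*𝒪(1) ⊗ pr₂^*𝒪(1)`
(Hartshorne II Ex. 5.11–5.12). Here `g_N` is a fixed rational multiple of the Euler class of the
tautological line bundle of `ℙ(ℂᴺ⁺¹)` transported along Serre's `projPoint : ℙ(ℂᴺ⁺¹) ≃ₜ ℙᴺ_ℂ(ℂ)`.
[cite: Hartshorne1977, II Ex. 5.11 and Ex. 5.12] [cite: MilnorStasheff1974, §14 p. 158] -/
theorem exists_segreHyperplaneClasses :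
    ∃ g : (N : ℕ) → complexBetti (projectiveSpace N ℂ) 2,
      (∀ N : ℕ, IsRationalClass (g N)) ∧ (∀ N : ℕ, 1 ≤ N → g N ≠ 0) ∧
      ∀ n m : ℕ, complexBetti.map (segreEmbedding n m ℂ) 2 (g (n * m + n + m)) =
        complexBetti.map (CartesianMonoidalCategory.fst (projectiveSpace n ℂ) (projectiveSpace m ℂ)) 2 (g n) +
          complexBetti.map (CartesianMonoidalCategory.snd (projectiveSpace n ℂ) (projectiveSpace m ℂ)) 2 (g m) := by
  obtain ⟨g, hg⟩ := exists_gen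
  obtain ⟨u, hu, hrat⟩ := exists_smul_gen_isRationalClass g hg
  refine ⟨fun N ↦ u • g N, hrat, fun N hN ↦ smul_ne_zero hu (gen_ne_zero g hg hN), fun n m ↦ ?_⟩
  simp only [map_smul, map_segreEmbedding_gen g hg, smul_add]

/-- **The `K`-symmetric weighted Segre embedding of `A × (E × E)`** (the geometric input of the aiming
step of the product trick; Markman §11.5 Step 2, Hartshorne II Ex. 5.11–5.12). For `(A, φ)` with
`φ ≫ φ = -(d • 𝟙)`, `d ≥ 1`, a complex elliptic curve `E` and a non-zero rational `η ∈ H²(E(ℂ); ℂ)`: a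
projective embedding `e_A` of `A` and a non-zero rational `a_A ∈ H²(ℙᴺ(ℂ))` whose hyperplane class
`h_A = e_A^* a_A` is `K`-symmetric, `φ^* h_A = d h_A` (the Segre embedding of the graph of `φ` in
`s_{d-1}(e₀) × e₀`, class `d h₀ + φ^*h₀`, with `φ^*φ^* = (-[d])^* = d²` on `H²`), and a rational `s` such
that for all weights `m₁, m₂ ≥ 1` the Segre embedding of `e_A` with `s_{m₁-1}(e_E) × s_{m₂-1}(e_E)` has
hyperplane class `pr_A^* h_A + s · pr_{E×E}^*(m₁ pr₁^* η + m₂ pr₂^* η)` (Segre additivity on `H²` of complex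
points, `exists_segreHyperplaneClasses`; `s_d^* g = (d+1) g`; `e_E^* g = s η` on the line `H²(E(ℂ); ℂ)`).
[cite: Hartshorne1977, II Ex. 5.11 and Ex. 5.12] [cite: Markman2025SurveySecant, §11.5 Step 2] -/
theorem exists_symmetricSegreEmbedding {d : ℕ} (hd : 0 < d) {A : AbelianVariety ℂ} {φ : A ⟶ A}
    (hφ : φ ≫ φ = -(d • 𝟙 A)) (E : AbelianVariety ℂ) (hE : E.dim = 1)
    (η : complexBetti E.X 2) (hη : IsRationalClass η) (hη0 : η ≠ 0) :
    ∃ (eA : ProjectiveEmbedding A.X) (aA : complexBetti (projectiveSpace eA.n ℂ) 2) (s : ℚ),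
      IsRationalClass aA ∧ aA ≠ 0 ∧
      complexBetti.map φ.hom.hom.hom 2 (complexBetti.map eA.ι 2 aA) = (d : ℂ) • complexBetti.map eA.ι 2 aA ∧
      ∀ (m₁ m₂ : ℕ), 0 < m₁ → 0 < m₂ →
        ∃ (e : ProjectiveEmbedding (A.prod (E.prod E)).X) (a : complexBetti (projectiveSpace e.n ℂ) 2),
          IsRationalClass a ∧ a ≠ 0 ∧
          complexBetti.map e.ι 2 a =
            complexBetti.map (AbelianVariety.fst A (E.prod E)).hom.hom.hom 2 (complexBetti.map eA.ι 2 aA) +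
            ((s : ℚ) : ℂ) • complexBetti.map (AbelianVariety.snd A (E.prod E)).hom.hom.hom 2
              (((m₁ : ℕ) : ℂ) • complexBetti.map (AbelianVariety.fst E E).hom.hom.hom 2 η +
                ((m₂ : ℕ) : ℂ) • complexBetti.map (AbelianVariety.snd E E).hom.hom.hom 2 η) := by
  obtain ⟨d', rfl⟩ : ∃ d', d = d' + 1 := ⟨d - 1, by omega⟩
  clear hd
  obtain ⟨g, hgr, hgnz, hgσ⟩ := exists_segreHyperplaneClasses
  obtain ⟨N, e₀, hN, he₀⟩ := exists_closedImmersion_projectiveSpace_pos A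
  obtain ⟨M, f₀, hM, hf₀⟩ := exists_closedImmersion_projectiveSpace_pos E
  haveI := he₀
  haveI := hf₀
  -- the `K`-symmetric embedding of `A`: graph of `φ`, then `s_{d'}(e₀) × e₀`, then Segre
  obtain ⟨ιA, hιA⟩ : ∃ ι : A.X ⟶ projectiveSpace (ProjectiveSpace.segrePowDim N d' * N + ProjectiveSpace.segrePowDim N d' + N) ℂ,
      ι = CartesianMonoidalCategory.lift (𝟙 A.X) φ.hom.hom.hom ≫
        ((e₀ ≫ ProjectiveSpace.segrePow N ℂ d') ⊗ₘ e₀) ≫ segreEmbedding (ProjectiveSpace.segrePowDim N d') N ℂ := ⟨_, rfl⟩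
  haveI := isClosedImmersion_segrePow_left N d'
  haveI : IsClosedImmersion (e₀ ≫ ProjectiveSpace.segrePow N ℂ d').left := by
    change IsClosedImmersion (e₀.left ≫ (ProjectiveSpace.segrePow N ℂ d').left); infer_instance
  haveI := isClosedImmersion_tensorHom_left (e₀ ≫ ProjectiveSpace.segrePow N ℂ d') e₀
  haveI := isClosedImmersion_lift_id_left (X := A.X) (Y := A.X) φ.hom.hom.hom
  haveI hιAci : IsClosedImmersion ιA.left := by
    rw [hιA]
    change IsClosedImmersion ((CartesianMonoidalCategory.lift (𝟙 A.X) φ.hom.hom.hom).left ≫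
      (((e₀ ≫ ProjectiveSpace.segrePow N ℂ d') ⊗ₘ e₀).left ≫ (segreEmbedding (ProjectiveSpace.segrePowDim N d') N ℂ).left))
    infer_instance
  let eA : ProjectiveEmbedding A.X := ⟨_, ιA, hιAci⟩
  obtain ⟨h₀, hh₀⟩ : ∃ h : complexBetti A.X 2, h = complexBetti.map e₀ 2 (g N) := ⟨_, rfl⟩
  have hA : complexBetti.map ιA 2 (g (ProjectiveSpace.segrePowDim N d' * N + ProjectiveSpace.segrePowDim N d' + N)) =
      ((d' + 1 : ℕ) : ℂ) • h₀ + complexBetti.map φ.hom.hom.hom 2 h₀ := by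
    rw [hιA, map_comp_apply', map_comp_apply', hgσ (ProjectiveSpace.segrePowDim N d') N, map_add, map_add,
      map_tensorHom_map_fst, map_tensorHom_map_snd, map_lift_map_fst, map_lift_map_snd, complexBetti.map_id,
      ModuleCat.id_apply, map_comp_apply', map_segrePow_of_additive g hgσ N d', map_smul, ← hh₀]
  -- the curve: `f₀^* g = s • η`
  obtain ⟨s, hs⟩ := exists_eq_ratCast_smul_of_curve E hE hη hη0 ((hgr M).pullback (AlgPoints.mapContinuous (L := ℂ) f₀))
  have hKA : 1 ≤ ProjectiveSpace.segrePowDim N d' * N + ProjectiveSpace.segrePowDim N d' + N := le_trans hN (Nat.le_add_left _ _)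
  refine ⟨eA, g _, s, hgr _, hgnz _ hKA, ?_, fun m₁ m₂ hm₁ hm₂ ↦ ?_⟩
  · -- `φ^* h_A = d h_A`
    change complexBetti.map φ.hom.hom.hom 2
        (complexBetti.map ιA 2 (g (ProjectiveSpace.segrePowDim N d' * N + ProjectiveSpace.segrePowDim N d' + N))) =
      ((d' + 1 : ℕ) : ℂ) • complexBetti.map ιA 2 (g (ProjectiveSpace.segrePowDim N d' * N + ProjectiveSpace.segrePowDim N d' + N))
    have hcomp : φ.hom.hom.hom ≫ φ.hom.hom.hom = (φ ≫ φ).hom.hom.hom := rfl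
    rw [hA, map_add, map_smul, ← map_comp_apply', hcomp, hφ, complexBetti_map_neg_nsmul_id_two, smul_add, smul_smul,
      ← pow_two, add_comm]
  · -- the weighted Segre embedding of `A × (E × E)`
    obtain ⟨d₁, rfl⟩ : ∃ d, m₁ = d + 1 := ⟨m₁ - 1, by omega⟩
    obtain ⟨d₂, rfl⟩ : ∃ d, m₂ = d + 1 := ⟨m₂ - 1, by omega⟩
    obtain ⟨ιE, hιE⟩ : ∃ ι : E.X ⊗ E.X ⟶ projectiveSpace (ProjectiveSpace.segrePowDim M d₁ * ProjectiveSpace.segrePowDim M d₂ +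
        ProjectiveSpace.segrePowDim M d₁ + ProjectiveSpace.segrePowDim M d₂) ℂ,
        ι = ((f₀ ≫ ProjectiveSpace.segrePow M ℂ d₁) ⊗ₘ (f₀ ≫ ProjectiveSpace.segrePow M ℂ d₂)) ≫
          segreEmbedding (ProjectiveSpace.segrePowDim M d₁) (ProjectiveSpace.segrePowDim M d₂) ℂ := ⟨_, rfl⟩
    haveI := isClosedImmersion_segrePow_left M d₁
    haveI := isClosedImmersion_segrePow_left M d₂
    haveI : IsClosedImmersion (f₀ ≫ ProjectiveSpace.segrePow M ℂ d₁).left := by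
      change IsClosedImmersion (f₀.left ≫ (ProjectiveSpace.segrePow M ℂ d₁).left); infer_instance
    haveI : IsClosedImmersion (f₀ ≫ ProjectiveSpace.segrePow M ℂ d₂).left := by
      change IsClosedImmersion (f₀.left ≫ (ProjectiveSpace.segrePow M ℂ d₂).left); infer_instance
    haveI := isClosedImmersion_tensorHom_left (X := E.X) (Y := E.X) (f₀ ≫ ProjectiveSpace.segrePow M ℂ d₁)
      (f₀ ≫ ProjectiveSpace.segrePow M ℂ d₂)
    haveI hιEci : IsClosedImmersion ιE.left := by
      rw [hιE]
      change IsClosedImmersion (((f₀ ≫ ProjectiveSpace.segrePow M ℂ d₁) ⊗ₘ (f₀ ≫ ProjectiveSpace.segrePow M ℂ d₂)).left ≫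
        (segreEmbedding (ProjectiveSpace.segrePowDim M d₁) (ProjectiveSpace.segrePowDim M d₂) ℂ).left)
      infer_instance
    obtain ⟨ι, hι⟩ : ∃ ι : A.X ⊗ (E.X ⊗ E.X) ⟶ projectiveSpace
        ((ProjectiveSpace.segrePowDim N d' * N + ProjectiveSpace.segrePowDim N d' + N) *
          (ProjectiveSpace.segrePowDim M d₁ * ProjectiveSpace.segrePowDim M d₂ + ProjectiveSpace.segrePowDim M d₁ +
            ProjectiveSpace.segrePowDim M d₂) +
          (ProjectiveSpace.segrePowDim N d' * N + ProjectiveSpace.segrePowDim N d' + N) +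
          (ProjectiveSpace.segrePowDim M d₁ * ProjectiveSpace.segrePowDim M d₂ + ProjectiveSpace.segrePowDim M d₁ +
            ProjectiveSpace.segrePowDim M d₂)) ℂ,
        ι = (ιA ⊗ₘ ιE) ≫ segreEmbedding _ _ ℂ := ⟨_, rfl⟩
    haveI := isClosedImmersion_tensorHom_left (X := A.X) (Y := E.X ⊗ E.X) ιA ιE
    have hιci : IsClosedImmersion ι.left := by
      rw [hι]
      change IsClosedImmersion ((ιA ⊗ₘ ιE).left ≫ (segreEmbedding _ _ ℂ).left)
      infer_instance
    have hKK : 1 ≤ (ProjectiveSpace.segrePowDim N d' * N + ProjectiveSpace.segrePowDim N d' + N) *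
          (ProjectiveSpace.segrePowDim M d₁ * ProjectiveSpace.segrePowDim M d₂ + ProjectiveSpace.segrePowDim M d₁ +
            ProjectiveSpace.segrePowDim M d₂) +
          (ProjectiveSpace.segrePowDim N d' * N + ProjectiveSpace.segrePowDim N d' + N) +
          (ProjectiveSpace.segrePowDim M d₁ * ProjectiveSpace.segrePowDim M d₂ + ProjectiveSpace.segrePowDim M d₁ +
            ProjectiveSpace.segrePowDim M d₂) :=
      le_trans hKA ((Nat.le_add_left _ _).trans (Nat.le_add_right _ _))
    refine ⟨⟨_, ι, hιci⟩, g _, hgr _, hgnz _ hKK, ?_⟩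
    -- `ι_E^* g = m₁ pr₁^* (f₀^* g) + m₂ pr₂^* (f₀^* g)`
    have hEcl : complexBetti.map ιE 2 (g _) =
        ((d₁ + 1 : ℕ) : ℂ) • complexBetti.map (fst E.X E.X) 2 (complexBetti.map f₀ 2 (g M)) +
          ((d₂ + 1 : ℕ) : ℂ) • complexBetti.map (snd E.X E.X) 2 (complexBetti.map f₀ 2 (g M)) := by
      rw [hιE, map_comp_apply', hgσ (ProjectiveSpace.segrePowDim M d₁) (ProjectiveSpace.segrePowDim M d₂), map_add,
        map_tensorHom_map_fst, map_tensorHom_map_snd, map_comp_apply', map_comp_apply',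
        map_segrePow_of_additive g hgσ M d₁, map_segrePow_of_additive g hgσ M d₂]
      simp only [map_smul]
    have final : complexBetti.map ι 2 (g _) =
        complexBetti.map (fst A.X (E.X ⊗ E.X)) 2
            (complexBetti.map ιA 2 (g (ProjectiveSpace.segrePowDim N d' * N + ProjectiveSpace.segrePowDim N d' + N))) +
          ((s : ℚ) : ℂ) • complexBetti.map (snd A.X (E.X ⊗ E.X)) 2
            (((d₁ + 1 : ℕ) : ℂ) • complexBetti.map (fst E.X E.X) 2 η + ((d₂ + 1 : ℕ) : ℂ) • complexBetti.map (snd E.X E.X) 2 η) := by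
      rw [hι, map_comp_apply', hgσ, map_add, map_tensorHom_map_fst, map_tensorHom_map_snd, hEcl, hs]
      simp only [map_add, map_smul, smul_add, smul_smul, mul_comm]
    exact final

end Literature.AlgebraicGeometry.Motives

end
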